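import Summits.Ventures.PercRepro.C026PFunTreeSums
import Summits.Ventures.PercRepro.C026PFunBracket

/-!
# THEOREM T: CONJECTURE (P) holds on every tree skeleton (p6, gen 16; mine-3 §28)

`IsTree G c F`: the edge set `F` is a tree containing the probe `c` (`F = ∅` allowed), built by gluing
pendant subtrees at the root (`IsGlue`).  The invariant `TreeInv` records the four configuration sums of
a tree as products over its subtrees' VIRTUAL COMPONENTS `(m̂_i, ẑ_i, P_i)` (mine-3 §28 (i)):

`ρⁿ·(m̂, ẑ, ĉ, d̂) = ρ_c·(∏(3m̂_i − ẑ_i), x_c∏2m̂_i, K_c∏(P_i + 2ẑ_i), K_c x_c∏(P_i − m̂_i + 3ẑ_i))`,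

so that `ρⁿ·(P) = ρ_c·∏m̂_i·Br(ξ, π̃, x_c, K_c)` with `ξ_i = ẑ_i/m̂_i`, `π̃_i = P_i/m̂_i`, and the bracket is
`≥ 0` by `bracket_nonneg` (THEOREM S with virtual components).  **THEOREM T (`IsTree.pFun_nonneg`)**:
`(P_F) ≥ 0` for every tree skeleton and every band state.
-/

namespace PercRepro

namespace MultiGraph

open Finset

variable {V E : Type*} [Fintype V] [DecidableEq V] [Fintype E] [DecidableEq E] {G : MultiGraph V E}

/-- `IsTree G c F`: `F` is a tree with root (probe) `c`, obtained from the bare root by gluing pendant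
subtrees (`IsGlue`) one at a time. -/
inductive IsTree (G : MultiGraph V E) : V → Finset E → Prop
  | nil (c : V) : IsTree G c ∅
  | glue {c u : V} {e : E} {F₀ F₁ : Finset E} (hg : IsGlue G F₀ e F₁ c u) (h₀ : IsTree G c F₀)
      (h₁ : IsTree G u F₁) : IsTree G c (F₀ ∪ insert e F₁)

/-! ### The edgeless skeleton -/

section Empty

variable (x K : V → ℝ) (c : V)

omit [Fintype V] [DecidableEq V] [Fintype E] in
/-- The complement of the all-closed configuration inside `∅`. -/
theorem complIn_empty_false : complIn (∅ : Finset E) (fun _ : E => false) = fun _ => false := by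
  funext f
  simp [complIn]

/-- `m̂` of the edgeless skeleton: the all-closed `N_c`. -/
theorem mSum_empty : G.mSum x c ∅ = G.nbarOff x c (fun _ => false) := by
  unfold mSum
  rw [configsIn_empty, Finset.sum_singleton]

omit [DecidableEq V] [Fintype E] [DecidableEq E] in
/-- `X_c` of the all-closed configuration is `x c`. -/
theorem xCluster_false : G.xCluster x c (fun _ : E => false) = x c := by
  unfold xCluster
  rw [clusterF_eq_singleton_of_forall_false (fun _ => rfl) c, Finset.prod_singleton]

omit [DecidableEq V] [Fintype E] [DecidableEq E] in
/-- `K_c` of the all-closed configuration is `K c`. -/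
theorem kCluster_false : G.kCluster K c (fun _ : E => false) = K c := by
  unfold kCluster
  rw [clusterF_eq_singleton_of_forall_false (fun _ => rfl) c, Finset.prod_singleton]

/-- `ẑ` of the edgeless skeleton. -/
theorem zSum_empty : G.zSum x c ∅ = x c * G.nbarOff x c (fun _ => false) := by
  unfold zSum
  rw [configsIn_empty, Finset.sum_singleton, xCluster_false]

/-- `ĉ` of the edgeless skeleton. -/
theorem sC_empty : G.sC c x K ∅ = K c * G.nbarOff x c (fun _ => false) := by
  unfold sC
  rw [configsIn_empty, Finset.sum_singleton, complIn_empty_false, kCluster_false]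

/-- `d̂` of the edgeless skeleton. -/
theorem sD_empty : G.sD c x K ∅ = K c * (x c * G.nbarOff x c (fun _ => false)) := by
  unfold sD
  rw [configsIn_empty, Finset.sum_singleton, complIn_empty_false, kCluster_false, xCluster_false]

end Empty

/-! ### The invariant -/

/-- The bounds of a virtual component `(m̂, ẑ, P)`: `m̂ ≥ 1`, `0 ≤ ẑ ≤ m̂`, `P ≥ 0`, `P ≥ m̂ − 2ẑ`. -/
def VirtualOK (d : ℝ × ℝ × ℝ) : Prop :=
  1 ≤ d.1 ∧ 0 ≤ d.2.1 ∧ d.2.1 ≤ d.1 ∧ 0 ≤ d.2.2 ∧ d.1 - 2 * d.2.1 ≤ d.2.2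

variable (G) in
/-- `TreeInv G c x K F`: the four sums of `(G, F, c)` are the products of the tree recursion over some
family of virtual components. -/
def TreeInv (c : V) (x K : V → ℝ) (F : Finset E) : Prop :=
  ∃ (n : ℕ) (d : Fin n → ℝ × ℝ × ℝ), (∀ i, VirtualOK (d i)) ∧
    rhoAll x ^ n * G.mSum x c F =
      G.nbarOff x c (fun _ => false) * ∏ i, (3 * (d i).1 - (d i).2.1) ∧
    rhoAll x ^ n * G.zSum x c F =
      G.nbarOff x c (fun _ => false) * x c * ∏ i, (2 * (d i).1) ∧
    rhoAll x ^ n * G.sC c x K F =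
      G.nbarOff x c (fun _ => false) * K c * ∏ i, ((d i).2.2 + 2 * (d i).2.1) ∧
    rhoAll x ^ n * G.sD c x K F =
      G.nbarOff x c (fun _ => false) * K c * x c * ∏ i, ((d i).2.2 - (d i).1 + 3 * (d i).2.1)

/-- The bare root satisfies the invariant (no components). -/
theorem treeInv_empty (c : V) (x K : V → ℝ) : G.TreeInv c x K ∅ := by
  refine ⟨0, fun i => Fin.elim0 i, fun i => Fin.elim0 i, ?_, ?_, ?_, ?_⟩ <;>
    simp [mSum_empty, zSum_empty, sC_empty, sD_empty, mul_comm, mul_left_comm]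

/-- **Positivity from the invariant**: `ρⁿ·(P) = ρ_c·∏m̂_i·Br(ξ, π̃, x_c, K_c) ≥ 0`. -/
theorem pFun_nonneg_of_treeInv {c : V} {x K : V → ℝ} (hx : ∀ v, 0 ≤ x v ∧ x v ≤ 1)
    (hK : ∀ v, kMin (x v) ≤ K v) {F : Finset E} (h : G.TreeInv c x K F) : 0 ≤ G.pFun c x K F := by
  obtain ⟨n, d, hd, hm, hz, hc, hdd⟩ := h
  have hρ : 0 < rhoAll x := by linarith [one_le_rhoAll (V := V) hx]
  have hρn : 0 < rhoAll x ^ n := pow_pos hρ n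
  have hρc : 0 ≤ G.nbarOff x c (fun _ => false) := nbarOff_nonneg hx c _
  have hmpos : ∀ i, 0 < (d i).1 := fun i => by linarith [(hd i).1]
  have hprod : 0 ≤ ∏ i, (d i).1 := Finset.prod_nonneg fun i _ => (hmpos i).le
  -- the virtual components
  set ξ : Fin n → ℝ := fun i => (d i).2.1 / (d i).1 with hξ
  set π : Fin n → ℝ := fun i => (d i).2.2 / (d i).1 with hπ
  have hξm : ∀ i, 0 ≤ ξ i ∧ ξ i ≤ 1 := fun i =>
    ⟨div_nonneg (hd i).2.1 (hmpos i).le, (div_le_one (hmpos i)).2 (hd i).2.2.1⟩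
  have hπm : ∀ i, max 0 (1 - 2 * ξ i) ≤ π i := fun i => by
    refine max_le (div_nonneg (hd i).2.2.2.1 (hmpos i).le) ?_
    rw [hπ, hξ]
    simp only
    rw [le_div_iff₀ (hmpos i)]
    have := (hd i).2.2.2.2
    have hne : (d i).1 ≠ 0 := (hmpos i).ne'
    have e : (1 - 2 * ((d i).2.1 / (d i).1)) * (d i).1 = (d i).1 - 2 * (d i).2.1 := by
      field_simp
    rw [e]
    exact this
  have hbr := bracket_nonneg hξm hπm (hx c) (hK c)
  -- the four products factor `∏ m̂_i`
  have e1 : ∏ i, (3 * (d i).1 - (d i).2.1) = (∏ i, (d i).1) * ∏ i, (3 - ξ i) := by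
    rw [← Finset.prod_mul_distrib]
    refine Finset.prod_congr rfl fun i _ => ?_
    have hne : (d i).1 ≠ 0 := (hmpos i).ne'
    rw [hξ]
    simp only
    field_simp
  have e2 : ∏ i, (2 * (d i).1) = (∏ i, (d i).1) * 2 ^ n := by
    rw [Finset.prod_mul_distrib, Finset.prod_const, Finset.card_univ, Fintype.card_fin, mul_comm]
  have e3 : ∏ i, ((d i).2.2 + 2 * (d i).2.1) = (∏ i, (d i).1) * ∏ i, (π i + 2 * ξ i) := by
    rw [← Finset.prod_mul_distrib]
    refine Finset.prod_congr rfl fun i _ => ?_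
    have hne : (d i).1 ≠ 0 := (hmpos i).ne'
    rw [hξ, hπ]
    simp only
    field_simp
  have e4 : ∏ i, ((d i).2.2 - (d i).1 + 3 * (d i).2.1) =
      (∏ i, (d i).1) * ∏ i, (π i + 3 * ξ i - 1) := by
    rw [← Finset.prod_mul_distrib]
    refine Finset.prod_congr rfl fun i _ => ?_
    have hne : (d i).1 ≠ 0 := (hmpos i).ne'
    rw [hξ, hπ]
    simp only
    field_simp
    ring
  have key : rhoAll x ^ n * G.pFun c x K F =
      G.nbarOff x c (fun _ => false) * (∏ i, (d i).1) * bracket ξ π (x c) (K c) := by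
    rw [pFun_eq_sums]
    unfold bracket
    rw [Fintype.card_fin]
    linear_combination hm - 2 * hz + 2 * hc - hdd + G.nbarOff x c (fun _ => false) * (
      (e1 - 2 * x c * e2 + 2 * K c * e3 - K c * x c * e4))
  have : 0 ≤ rhoAll x ^ n * G.pFun c x K F := by
    rw [key]
    exact mul_nonneg (mul_nonneg hρc hprod) hbr
  exact nonneg_of_mul_nonneg_right this hρn

/-- **The glue step of the invariant**: a pendant tree with root `u` adds its virtual component. -/
theorem treeInv_glue {F₀ F₁ : Finset E} {e : E} {c u : V} (hg : IsGlue G F₀ e F₁ c u)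
    {x K : V → ℝ} (hx : ∀ v, 0 ≤ x v ∧ x v ≤ 1) (hK : ∀ v, kMin (x v) ≤ K v)
    (h₀ : G.TreeInv c x K F₀) (h₁ : G.TreeInv u x K F₁) :
    G.TreeInv c x K (F₀ ∪ insert e F₁) := by
  obtain ⟨n, d, hd, hm, hz, hc, hdd⟩ := h₀
  have hP₁ : 0 ≤ G.pFun u x K F₁ := pFun_nonneg_of_treeInv hx hK h₁
  have hK0 : ∀ v, 0 ≤ K v := fun v => (kMin_nonneg _).trans (hK v)
  refine ⟨n + 1, Fin.cons (G.mSum x u F₁, G.zSum x u F₁, G.pFun u x K F₁) d, ?_, ?_, ?_, ?_, ?_⟩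
  · intro i
    refine Fin.cases ?_ (fun j => ?_) i
    · rw [Fin.cons_zero]
      refine ⟨one_le_mSum hx u F₁, (zSum_le_mSum hx u F₁).1, (zSum_le_mSum hx u F₁).2, hP₁,
        mSum_sub_two_zSum_le_pFun hx hK0 u F₁⟩
    · rw [Fin.cons_succ]
      exact hd j
  · rw [pow_succ, mul_assoc, hg.mSum_glue x hx, nSum_eq x u,
      Fin.prod_univ_succ, Fin.cons_zero]
    simp only [Fin.cons_succ]
    linear_combination (3 * G.mSum x u F₁ - G.zSum x u F₁) * hm
  · rw [pow_succ, mul_assoc, hg.zSum_glue x hx, nSum_eq x u,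
      Fin.prod_univ_succ, Fin.cons_zero]
    simp only [Fin.cons_succ]
    linear_combination (2 * G.mSum x u F₁) * hz
  · rw [pow_succ, mul_assoc, hg.sC_glue x K hx, cSum_eq,
      Fin.prod_univ_succ, Fin.cons_zero]
    simp only [Fin.cons_succ]
    linear_combination (G.pFun u x K F₁ + 2 * G.zSum x u F₁) * hc
  · rw [pow_succ, mul_assoc, hg.sD_glue x K hx, cSum_eq,
      Fin.prod_univ_succ, Fin.cons_zero]
    simp only [Fin.cons_succ]
    linear_combination (G.pFun u x K F₁ - G.mSum x u F₁ + 3 * G.zSum x u F₁) * hdd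

/-- Every tree satisfies the invariant. -/
theorem IsTree.treeInv {c : V} {F : Finset E} (h : IsTree G c F) {x K : V → ℝ}
    (hx : ∀ v, 0 ≤ x v ∧ x v ≤ 1) (hK : ∀ v, kMin (x v) ≤ K v) : G.TreeInv c x K F := by
  induction h with
  | nil c => exact treeInv_empty c x K
  | glue hg _ _ ih₀ ih₁ => exact treeInv_glue hg hx hK ih₀ ih₁

/-- **THEOREM T (mine-3 §28)**: CONJECTURE (P) holds on every tree skeleton — `(P_F) ≥ 0` for every
tree `F` rooted at the probe `c` and every band state (`x ∈ [0, 1]`, `K ≥ K_min(x)`). -/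
theorem IsTree.pFun_nonneg {c : V} {F : Finset E} (h : IsTree G c F) {x K : V → ℝ}
    (hx : ∀ v, 0 ≤ x v ∧ x v ≤ 1) (hK : ∀ v, kMin (x v) ≤ K v) : 0 ≤ G.pFun c x K F :=
  pFun_nonneg_of_treeInv hx hK (h.treeInv hx hK)

end MultiGraph

end PercRepro
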